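import Literature.NumberTheory.Transcendental.PhilipponCriterionRank
import HarnessLib

/-!
# A subscheme squeezed between an integral scheme and a component of the same dimension is the whole scheme

Elementary dimension theory [folklore], recorded because it is the "embedding-dimension lemma" by which
a Hodge-locus census turns an order-`N` computation into a statement about components (H. Movasati,
arXiv:1602.06607, Thm. 2–3 and §7, "`N`-smooth / `N`-reduced" Hodge loci; the inference itself is not
printed there and is supplied here):

Let `R` be a commutative ring (in the application the local ring `𝓞_{T,0}` of the parameter space),
`P` a PRIME ideal (the ideal of a smooth — hence integral — germ `W ∋ 0` cut out by `rank`-many of the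
defining equations with independent differentials, so that `dim W = dim T_0 V`), `I ⊇ P` any ideal (the
ideal of the Hodge locus `V`; `V ⊆ W` because the equations of `W` are among those of `V`), and
`q ⊇ I` an ideal with `dim R/q = dim R/P < ∞` (a component `B ⊆ V` through `0` of
dimension `dim W = dim T_0V`). Then `q = P` and `I = P`: **`V = W` as schemes** — smooth and reduced.
Contrapositively: if `V ≠ W` (e.g. `V` is not `N`-reduced for some `N`, i.e. `I ≠ P mod 𝔪^{N+1}`), then
NO component of `V` through `0` has dimension `dim T_0 V`.

The proof is the chain count `dim R/q + 1 ≤ dim R/P` for `P < q`, `P` prime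
(`Literature.NumberTheory.Transcendental.PhilipponMain.eq_of_le_of_ringKrullDim_quotient_eq`, reused —
no catenarity or regularity is needed for this step; regularity of `R/P` enters only to know that `P`
is prime, which is a hypothesis here).
-/

namespace Literature.RingTheory.KrullDimension

/-- **Squeeze lemma for subschemes of full dimension.** `P` prime, `P ≤ I ≤ q`, and
`dim (R ⧸ P) = dim (R ⧸ q) = d ∈ ℕ` imply `q = P` and `I = P`. Geometrically: a closed subscheme
`V = V(I)` of an integral scheme `W = V(P)` which contains a closed subscheme `B = V(q)` of the same finite
dimension as `W` equals `W` scheme-theoretically (in particular `V` is reduced and irreducible).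
[folklore] -/
theorem eq_of_prime_le_le_of_ringKrullDim_eq {R : Type*} [CommRing R] {P I q : Ideal R}
    (hP : P.IsPrime) (hPI : P ≤ I) (hIq : I ≤ q) {d : ℕ} (hdP : ringKrullDim (R ⧸ P) = d)
    (hdq : ringKrullDim (R ⧸ q) = d) : q = P ∧ I = P := by
  have hPq : P = q :=
    Literature.NumberTheory.Transcendental.PhilipponMain.eq_of_le_of_ringKrullDim_quotient_eq hP
      (hPI.trans hIq) hdP hdq
  subst hPq
  exact ⟨rfl, le_antisymm hIq hPI⟩

/-- The form used by a Hodge-locus census (Movasati's `N`-reducedness test): if the zero scheme `V = V(I)`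
inside the smooth germ `W = V(P)` (`P` prime, `P ≤ I`) is NOT all of `W` (`I ≠ P`, detected e.g. by
`I ≠ P` modulo a power of the maximal ideal), then no ideal `q ⊇ I` — in particular no minimal prime of
`I`, i.e. no irreducible component of `V` — has `dim (R ⧸ q) = dim (R ⧸ P)` (finite). [folklore] -/
theorem ringKrullDim_quotient_ne_of_ne {R : Type*} [CommRing R] {P I q : Ideal R} (hP : P.IsPrime)
    (hPI : P ≤ I) (hIq : I ≤ q) (hne : I ≠ P) {d : ℕ} (hdP : ringKrullDim (R ⧸ P) = d) :
    ringKrullDim (R ⧸ q) ≠ d :=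
  fun hdq ↦ hne (eq_of_prime_le_le_of_ringKrullDim_eq hP hPI hIq hdP hdq).2

/-- Conversely packaged: under `P ≤ I ≤ q`, `P` prime, equal finite dimensions of `R ⧸ P` and `R ⧸ q`
force the three quotients to coincide — `R ⧸ I` is then the integral ring `R ⧸ P` (so `V` is reduced
and irreducible, and smooth when `W` is). [folklore] -/
theorem isPrime_of_prime_le_le_of_ringKrullDim_eq {R : Type*} [CommRing R] {P I q : Ideal R}
    (hP : P.IsPrime) (hPI : P ≤ I) (hIq : I ≤ q) {d : ℕ} (hdP : ringKrullDim (R ⧸ P) = d)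
    (hdq : ringKrullDim (R ⧸ q) = d) : I.IsPrime := by
  rw [(eq_of_prime_le_le_of_ringKrullDim_eq hP hPI hIq hdP hdq).2]
  exact hP

end Literature.RingTheory.KrullDimension
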